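import Summits.Langlands.Langlands.Theorems.IrreducibilityBySelfDualityGaloisRepGL2CMaeMemberTwo
import HarnessLib

/-!
# Crux `GaloisRepGL2CMae` (stmt-Langlands-16722), line `Sketch`, stub `stub_patching`

Helper file of the crux line `Cruxes/GaloisRepGL2CMae/Lines/Sketch.lean` (registered stub S7,
`--supports stmt-Langlands-16722`).  The **patching step at `n = 2`, almost everywhere, with the
unramified alternative only**:

  `Thm713UnramTwoCM → ACArchTwo → ACCuspTwo → GaloisRepGL2CMae` (body),

where `Thm713UnramTwoCM` is Harris–Lan–Taylor–Thorne's Thm. 7.13 at `n = 2` for CM fields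
`K ⊇ E₀` (imaginary quadratic, `p` split in `E₀`) with ONLY the second printed alternative on `q`
("`F` and `π` unramified above `q`"), and `ACArchTwo`, `ACCuspTwo` are the `n = 2` instances of
Arthur–Clozel's archimedean clause (`ArthurClozel1989_strongLifting_archimedean`) and strong cuspidal
prime-degree base change (`ArthurClozel1989_strongLifting_cuspidal`, route item
`ACStrongCuspidalBaseChangePrime`).

Proof (HLTT Cor. 7.14, p. 232, run at `n = 2` and read off only almost everywhere): the member
representations `ρ_D` of `exists_rep_member_two` (sibling file `…GaloisRepGL2CMaeMemberTwo`: strong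
base change to `K_D = K(√-D)`, `D ∈ GoodPrime K (8ℓ) B`, Thm. 7.13 with the unramified alternative,
compatibility almost everywhere and at every place over the rational primes `q ∉ B ∪ {ℓ}` with
`8q ∣ D + 1`) are patched by Sorensen's lemma (`GoodPrime.exists_framedGaloisRep_of_compatibleAE`,
proved in the tree) and read off on the cofinite set `T` of places of `K` over the rational primes
`q ∉ B ∪ {ℓ}` (`B` = the finitely many primes below a place ramified over `ℤ` or a ramified place of
`σ`), through a member with `8q ∣ D + 1` in which `v` splits completely (`GoodPrime.exists_dvd_split`).

References: Harris–Lan–Taylor–Thorne, Res. Math. Sci. 3:37 (2016), Thm. 7.13, Cor. 7.14 (p. 232)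
[HarrisLanTaylorThorneRMS2016]; Harris–Taylor, Ann. of Math. Stud. 151, proof of Thm. VII.1.9
[HarrisTaylorAMS2001]; C. Sorensen, A patching lemma (2020) [Sorensen2020].
-/

noncomputable section

set_option linter.dupNamespace false -- project-wide option; `Summit.Langlands.Langlands` is the mandated namespace (D-0017)

open scoped MatrixGroups Matrix NumberField Polynomial
open NumberField IsDedekindDomain Field Polynomial Filter
open Literature.NumberTheory.Automorphic Literature.NumberTheory.GaloisRepresentations
open Literature.NumberTheory.GaloisRepresentations.QuadraticFamily
open Literature.NumberTheory.Automorphic.PatchingFamily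
open Literature.NumberTheory.Automorphic.HarrisLanTaylorThorne2016

namespace Summit.Langlands.Langlands.Theorems.GaloisRepGL2CMae

/-! ### The patching step -/

/-- **S7 `stub_patching` of the crux line `Cruxes/GaloisRepGL2CMae/Lines/Sketch.lean`**
(stmt-Langlands-16722): Harris–Lan–Taylor–Thorne's Thm. 7.13 at `n = 2` for CM fields containing an
imaginary quadratic field in which `p` splits, with the UNRAMIFIED alternative only, together with
Arthur–Clozel's archimedean clause and strong cuspidal prime-degree base change at `n = 2`, imply
the crux `GaloisRepGL2CMae` (HLTT Thm. A for `GL₂` over CM fields, almost everywhere; the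
conclusion below is the route decl's body verbatim).  Proof: Cor. 7.14's patching argument at
`n = 2` (`exists_rep_member_two` for the members of the `∅`-general family `K(√-D)`,
`D ∈ GoodPrime K (8ℓ) B`; `GoodPrime.exists_framedGaloisRep_of_compatibleAE`, Sorensen's lemma,
proved in the tree), read off on the cofinite set `T` of places over the rational primes
`q ∉ B ∪ {ℓ}`, through a member with `8q ∣ D + 1` in which `v` splits completely.
[cite: HarrisLanTaylorThorneRMS2016, Thm. 7.13 and Cor. 7.14 (p. 232)]
[cite: HarrisTaylorAMS2001, proof of Thm. VII.1.9 (pp. 229–232)] -/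
theorem stub_patching :
    (∀ (K : Type) [Field K] [NumberField K], IsCMField K →
      ∀ (hcpt : isCompact_glFiniteIntegralLevel 2 K) (p : ℕ) [Fact p.Prime]
        (E₀ : IntermediateField ℚ K), Module.finrank ℚ E₀ = 2 ∧ IsTotallyComplex E₀ →
        HasTwoPrimesOver E₀ p →
      ∀ (π : CuspidalAutomorphicRepData 2 K hcpt), π.1.IsRegularAlgebraic →
      ∀ (ι : PadicAlgCl p ≃+* ℂ),
      ∃ r : FramedGaloisRep K (PadicAlgCl p) 2, r.toGaloisRep.IsSemisimple ∧
        ∀ q : ℕ, q.Prime → q ≠ p → Algebra.IsUnramifiedIn (𝓞 K) (Ideal.span {(q : ℤ)}) →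
          π.1.IsUnramifiedAbove q →
          ∀ v : HeightOneSpectrum (𝓞 K), ((q : ℕ) : 𝓞 K) ∈ v.asIdeal →
            IsGaloisCompatibleAt π.1 ι r v) →
    (∀ (F E : Type) [Field F] [NumberField F] [Field E] [NumberField E] [Algebra F E]
      [IsGalois F E] (hF : isCompact_glFiniteIntegralLevel 2 F)
      (hE : isCompact_glFiniteIntegralLevel 2 E), IsCyclic (E ≃ₐ[F] E) →
        (Module.finrank F E).Prime →
          ∀ (π : CuspidalAutomorphicRepData 2 F hF) (P : CuspidalAutomorphicRepData 2 E hE),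
            IsWeakBaseChangeLiftAE π.1 P.1 →
              ∀ χ : (F →+* ℂ) → Multiset ℂ, π.1.HasArchParameter χ →
                P.1.HasArchParameter fun τ => χ (τ.comp (algebraMap F E))) →
    (∀ (F E : Type) [Field F] [NumberField F] [Field E] [NumberField E] [Algebra F E]
      [IsGalois F E], (Module.finrank F E).Prime →
      ∀ (hF : isCompact_glFiniteIntegralLevel 2 F) (π : CuspidalAutomorphicRepData 2 F hF),
        (∃ v : HeightOneSpectrum (𝓞 F),
            ¬ Algebra.IsUnramifiedIn (𝓞 E) v.asIdeal ∧ π.1.IsUnramifiedAt v) →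
        ∀ (hE : isCompact_glFiniteIntegralLevel 2 E),
          ∃ P : CuspidalAutomorphicRepData 2 E hE,
            ∀ (w : HeightOneSpectrum (𝓞 E)) (v : HeightOneSpectrum (𝓞 F)) (α : Multiset ℂ),
              w.asIdeal.under (𝓞 F) = v.asIdeal → Algebra.IsUnramifiedIn (𝓞 E) v.asIdeal →
                π.1.HasSatakeParamAt v α →
                  P.1.HasSatakeParamAt w (α.map (· ^ w.asIdeal.inertiaDeg (𝓞 F)))) →
    ∀ (K : Type) [Field K] [NumberField K]
      (hcpt₂ : Literature.NumberTheory.Automorphic.isCompact_glFiniteIntegralLevel 2 K),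
      NumberField.IsCMField K →
      ∀ (σ : Literature.NumberTheory.Automorphic.CuspidalAutomorphicRepData 2 K hcpt₂),
      σ.1.IsRegularAlgebraic → ∀ (ℓ : ℕ) [Fact ℓ.Prime] (ι : PadicAlgCl ℓ ≃+* ℂ),
      ∃ ρ : Literature.NumberTheory.GaloisRepresentations.FramedGaloisRep K (PadicAlgCl ℓ) 2,
        ∀ᶠ v : IsDedekindDomain.HeightOneSpectrum (NumberField.RingOfIntegers K) in Filter.cofinite,
          ∀ β : Multiset ℂ, σ.1.HasSatakeParamAt v β →
            ρ.IsUnramifiedAt v ∧ ρ.HasFrobCharpolyAt v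
              (Literature.NumberTheory.Automorphic.arithFrobPolyOfSatake ι v.residueCard 2 β) := by
  intro h713 harch hBC K _ _ hcpt₂ hCM σ hσ ℓ _ ι
  classical
  have hℓ : ℓ.Prime := Fact.out
  -- the finite set `B` of bad rational primes
  choose f hf using fun w : HeightOneSpectrum (𝓞 K) ↦ exists_natPrime_natCast_mem w
  have hR : {w : HeightOneSpectrum (𝓞 K) | ¬ Algebra.IsUnramifiedAt ℤ w.asIdeal}.Finite := by
    refine (Ideal.finite_factors (differentIdeal_ne_bot (A := ℤ) (B := 𝓞 K))).subset
      fun w hw ↦ ?_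
    simp only [Set.mem_setOf_eq] at hw ⊢
    by_contra hdvd
    exact hw ((not_dvd_differentIdeal_iff (A := ℤ)).mp hdvd)
  have hcof : {w : HeightOneSpectrum (𝓞 K) | ¬ σ.1.IsUnramifiedAt w}.Finite :=
    σ.1.hasSatakeParamAt_cofinite_holds
  set B : Set ℕ := f '' ({w | ¬ Algebra.IsUnramifiedAt ℤ w.asIdeal} ∪ {w | ¬ σ.1.IsUnramifiedAt w})
    with hBdef
  have hBfin : B.Finite := (hR.union hcof).image f
  have hB : ∀ D : ℕ, D.Prime → D ∉ B → ∀ v : HeightOneSpectrum (𝓞 K),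
      ((D : ℕ) : 𝓞 K) ∈ v.asIdeal → Algebra.IsUnramifiedAt ℤ v.asIdeal ∧ σ.1.IsUnramifiedAt v := by
    intro D hD hDB v hv
    have hfv : f v = D := natPrime_eq_of_natCast_mem (hf v).1 hD (hf v).2 hv
    by_contra h
    rw [not_and_or] at h
    exact hDB ⟨v, by simpa [Set.mem_union, Set.mem_setOf_eq] using h, hfv⟩
  have hm : 8 * ℓ ≠ 0 := mul_ne_zero (by norm_num) hℓ.ne_zero
  -- the Frobenius datum of `σ` and the representations of the members
  obtain ⟨E, hE⟩ := exists_frobDatum σ.1 ι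
  choose ρ hρss hρc hρT using fun i : GoodPrime K (8 * ℓ) B ↦
    exists_rep_member_two h713 harch hBC hCM σ hσ ι E hE hB i
  -- the cofinite set `T` of places over the rational primes `q ∉ B ∪ {ℓ}`
  set T : Set (HeightOneSpectrum (𝓞 K)) :=
    {v | ∃ q : ℕ, q.Prime ∧ q ≠ ℓ ∧ q ∉ B ∧ ((q : ℕ) : 𝓞 K) ∈ v.asIdeal} with hTdef
  have hT : ∀ v ∈ T, ∃ i : GoodPrime K (8 * ℓ) B,
      (v.asIdeal.primesOver (𝓞 (sqrtNegField K i.1))).ncard = 2 ∧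
        ∀ w : HeightOneSpectrum (𝓞 (sqrtNegField K i.1)), w.asIdeal.under (𝓞 K) = v.asIdeal →
          (ρ i).IsUnramifiedAt w ∧
            (ρ i).HasFrobCharpolyAt w (((E v).map fun a ↦ Polynomial.X - C a).prod) := by
    rintro v ⟨q, hq, hqℓ, hqB, hqv⟩
    -- `q ∉ B`: `K` and `σ` are unramified above `q`
    have hKq : Algebra.IsUnramifiedIn (𝓞 K) (Ideal.span {(q : ℤ)}) := by
      intro P hP hover
      have hq0 : (q : ℤ) ≠ 0 := by exact_mod_cast hq.ne_zero
      have hqP : ((q : ℕ) : 𝓞 K) ∈ P := by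
        have h := Ideal.mem_span_singleton_self (q : ℤ)
        rw [hover.over, Ideal.under_def, Ideal.mem_comap] at h
        simpa using h
      have hP0 : P ≠ ⊥ := by
        intro h
        rw [h, Ideal.mem_bot] at hqP
        exact hq.ne_zero (by exact_mod_cast hqP)
      exact (hB q hq hqB ⟨P, hP, hP0⟩ hqP).1
    have hπq : σ.1.IsUnramifiedAbove q := fun w hw ↦ (hB q hq hqB w hw).2
    obtain ⟨i, hqi, hsplit⟩ := GoodPrime.exists_dvd_split K (8 * ℓ) B hm hBfin v (8 * q)
      (mul_ne_zero (by norm_num) hq.ne_zero)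
    refine ⟨i, ?_, fun w hwv ↦ ?_⟩
    · rw [finrank_sqrtNegField] at hsplit
      exact hsplit
    · obtain ⟨α, hα⟩ := hπq v hqv
      obtain ⟨hunr, hch⟩ := hρT i q hq hqℓ hKq hπq hqi v hqv w hwv α hα
      refine ⟨hunr, ?_⟩
      rw [hE v α hα]
      exact hch
  obtain ⟨r, -, -, hrT⟩ :=
    GoodPrime.exists_framedGaloisRep_of_compatibleAE hm hBfin E ρ hρss hρc T hT
  refine ⟨r, ?_⟩
  -- `T` is cofinite: its complement lies over the finitely many primes in `B ∪ {ℓ}`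
  have hover : ∀ {q : ℕ}, q ≠ 0 →
      {v : HeightOneSpectrum (𝓞 K) | ((q : ℕ) : 𝓞 K) ∈ v.asIdeal}.Finite := by
    intro q hq
    have hne : Ideal.span {((q : ℕ) : 𝓞 K)} ≠ ⊥ := by
      rw [Ne, Ideal.span_singleton_eq_bot]
      exact_mod_cast hq
    convert Ideal.finite_factors hne using 2 with v
    simp [Ideal.dvd_span_singleton]
  have hTcof : ∀ᶠ v : HeightOneSpectrum (𝓞 K) in cofinite, v ∈ T := by
    have hfin : (⋃ q ∈ insert ℓ B, {v : HeightOneSpectrum (𝓞 K) |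
        ((q : ℕ) : 𝓞 K) ∈ v.asIdeal ∧ q ≠ 0}).Finite := by
      refine (hBfin.insert ℓ).biUnion fun q _ ↦ ?_
      by_cases hq : q = 0
      · simp [hq]
      · exact (hover hq).subset fun v hv ↦ hv.1
    rw [Filter.eventually_cofinite]
    refine hfin.subset fun v hv ↦ ?_
    simp only [Set.mem_setOf_eq] at hv
    have hq : (f v).Prime := (hf v).1
    have hqv : ((f v : ℕ) : 𝓞 K) ∈ v.asIdeal := (hf v).2
    simp only [Set.mem_iUnion, Set.mem_setOf_eq, exists_prop]
    refine ⟨f v, ?_, hqv, hq.ne_zero⟩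
    by_contra hqmem
    rw [Set.mem_insert_iff, not_or] at hqmem
    exact hv ⟨f v, hq, hqmem.1, hqmem.2, hqv⟩
  filter_upwards [hTcof] with v hv β hβ
  obtain ⟨hunr, hch⟩ := hrT v hv
  refine ⟨hunr, ?_⟩
  rw [← hE v β hβ]
  exact hch

end Summit.Langlands.Langlands.Theorems.GaloisRepGL2CMae

end
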